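import Literature.NumberTheory.EllipticCurves.HeckeOperatorsProofs
import Literature.NumberTheory.EllipticCurves.Newforms
import HarnessLib

/-!
# Fourier coefficients of Hecke eigenforms on `Γ₀(N)`: `a_p = λ_p`, and multiplicity one for
# simultaneous eigenforms of all `T_p` (`Newforms`, `HeckeOperatorsProofs`, continued)

Consequences of the `q`-expansion of `T_p` on `S_k(Γ₀(N))`
(`qExpansion_coeff_heckeT_holds` of `HeckeOperatorsProofs`, Diamond–Shurman Prop. 5.2.2(a) and
Prop. 5.3.1: `a_n(T_p f) = a_{pn}(f) + 𝟙_N(p) p^{k-1} a_{n/p}(f)`, valid for **every** prime `p`,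
`T_p = U_p` for `p ∣ N`) for eigenforms, all proved:

* `qExpansion_coeff_smul`, `qExpansion_coeff_sub_smul`: `aₙ(c • f) = c aₙ(f)`,
  `aₙ(h - c • f) = aₙ(h) - c aₙ(f)`.
* `qExpansion_coeff_one_heckeT`: `a₁(T_p f) = a_p(f)`.
* `eq_coeff_of_heckeT_eq_smul`, `heckeEigenvalue_eq_coeff_of_isNormalized`: if `T_p f = λ f` and
  `a₁(f) = 1` then `λ = a_p(f)` (Diamond–Shurman Prop. 5.8.5; Atkin–Lehner 1970, Thm. 3); in
  particular `IsNewform0.heckeT_eq_coeff_smul`: **`T_p f = a_p(f) f` for a newform `f` and every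
  prime `p`**. (The named fact `IsNewform0.heckeEigenvalue_eq_coeff` of `Newforms` is the newform
  case of `heckeEigenvalue_eq_coeff_of_isNormalized`; its discharge
  `IsNewform0.heckeEigenvalue_eq_coeff_holds` lives in `PAdicLFunctionDistributionProofs` — refactor
  note: that discharge is the one-liner
  `fun hf p hp ↦ heckeEigenvalue_eq_coeff_of_isNormalized hf.2.2 hp (hf.2.1 p hp)` from this file,
  which both that file and `ModularSymbolsPeriodHomology` import.)
* `eq_zero_of_forall_heckeT_eq_smul_of_coeff_one_eq_zero`: **a simultaneous eigenform of all the
  `T_p`, `p` prime (including `U_p`, `p ∣ N`), with `a₁ = 0` is zero** — by strong induction on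
  `n`, `a_{pm} = λ_p a_m - 𝟙_N(p) p^{k-1} a_{m/p}` kills every coefficient, and a cusp form with
  vanishing `q`-expansion vanishes (Diamond–Shurman §5.8, the computation `a_n(f) = a₁(T_n f)`
  behind Thm. 5.8.2 and Prop. 5.8.5).
* `eq_smul_of_forall_heckeT_eq_smul`, `IsNewform0.mem_span_of_forall_heckeT_eq_smul`:
  **multiplicity one for simultaneous eigenforms of all `T_p`**: if `f` is normalised with
  `T_p f = λ_p f` for all primes `p` (e.g. a newform, `λ_p = a_p(f)`) and `T_p h = λ_p h` for all
  primes `p`, then `h = a₁(h) f ∈ ℂf` (apply the previous item to `h - a₁(h) f`).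

The last item is the form of multiplicity one used for the period lattice of a rational newform
(`ModularSymbolsPeriodHomology`): the joint eigenspace `⋂_p ker(T_p - a_p(f))` over **all** primes
is the line `ℂf`. It is elementary because the hypothesis includes the `U_p`, `p ∣ N`; the deeper
statement of Atkin–Lehner theory (Diamond–Shurman Thm. 5.8.2(b); Atkin–Lehner 1970, Thm. 5), where
only the `T_p` with `p ∤ N` are prescribed and oldforms have to be excluded, is *not* proved here
(cf. the named facts `IsNewform0.eq_of_heckeEigenvalue_eq`,
`IsNewform0.level_eq_of_heckeEigenvalue_eq` of `Newforms`).

## References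

* F. Diamond, J. Shurman, *A first course in modular forms*, GTM 228, Springer 2005, Prop. 5.2.2,
  Prop. 5.3.1, §5.8 (Def. 5.8.1, Thm. 5.8.2, Prop. 5.8.5).
* A. O. L. Atkin, J. Lehner, *Hecke operators on `Γ₀(m)`*, Math. Ann. 185 (1970), Thm. 3, Thm. 5.
-/

noncomputable section

open scoped MatrixGroups ModularForm

open CongruenceSubgroup UpperHalfPlane

namespace Literature.NumberTheory.EllipticCurves.ModularForms

/-! ### `q`-expansion coefficients of linear combinations -/

section Coefficients

variable (N : ℕ) [NeZero N] (k : ℤ)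

omit [NeZero N] in
/-- `q`-expansion coefficients are homogeneous: `aₙ(c • f) = c aₙ(f)`. [folklore] -/
theorem qExpansion_coeff_smul (c : ℂ) (f : CuspForm (Gamma0 N) k) (n : ℕ) :
    (qExpansion 1 ⇑(c • f)).coeff n = c * (qExpansion 1 ⇑f).coeff n := by
  have h : (⇑(c • f) : ℍ → ℂ) = c • ⇑f := by ext; simp
  rw [h, ModularForm.qExpansion_smul one_pos (one_mem_strictPeriods_gamma0 N) c f]
  simp

omit [NeZero N] in
/-- `q`-expansion coefficients of `h - c • f`: `aₙ(h - c • f) = aₙ(h) - c aₙ(f)`. [folklore] -/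
theorem qExpansion_coeff_sub_smul (h f : CuspForm (Gamma0 N) k) (c : ℂ) (n : ℕ) :
    (qExpansion 1 ⇑(h - c • f)).coeff n =
      (qExpansion 1 ⇑h).coeff n - c * (qExpansion 1 ⇑f).coeff n := by
  have hΓ := one_mem_strictPeriods_gamma0 N
  have h1 : (⇑(h - c • f) : ℍ → ℂ) = ⇑h - ⇑(c • f) := by ext; simp
  rw [h1, ModularForm.qExpansion_sub one_pos hΓ h (c • f), map_sub, qExpansion_coeff_smul]

variable {N k}

/-! ### `a₁(T_p f) = a_p(f)`; the eigenvalue of a normalised eigenform -/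

/-- `a₁(T_p f) = a_p(f)` for `p` prime (`qExpansion_coeff_heckeT_holds` at `n = 1`;
Diamond–Shurman Prop. 5.2.2(a), Prop. 5.3.1). [cite: DiamondShurman2005, Prop. 5.3.1] -/
theorem qExpansion_coeff_one_heckeT {p : ℕ} [NeZero p] (hp : p.Prime) (f : CuspForm (Gamma0 N) k) :
    (qExpansion 1 ⇑(heckeT (Gamma0 N) k p f)).coeff 1 = (qExpansion 1 ⇑f).coeff p := by
  rw [qExpansion_coeff_heckeT_holds N k f p hp 1, mul_one, if_neg hp.not_dvd_one]
  split_ifs <;> simp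

/-- If `T_p f = a • f` for a normalised `f` (`a₁ = 1`), then `a = a_p(f)`: compare the coefficients
of `q¹` (Diamond–Shurman Prop. 5.8.5 / proof of Thm. 5.8.2; Atkin–Lehner 1970, Thm. 3). [cite: DiamondShurman2005, Prop. 5.8.5] -/
theorem eq_coeff_of_heckeT_eq_smul {p : ℕ} [NeZero p] (hp : p.Prime) {f : CuspForm (Gamma0 N) k}
    {a : ℂ} (h : heckeT (Gamma0 N) k p f = a • f) (h1 : IsNormalized f) :
    a = (qExpansion 1 ⇑f).coeff p := by
  have this : (qExpansion 1 ⇑(heckeT (Gamma0 N) k p f)).coeff 1 =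
      (qExpansion 1 ⇑(a • f)).coeff 1 := by
    rw [h]
  rw [qExpansion_coeff_one_heckeT hp, qExpansion_coeff_smul] at this
  rw [this, show (qExpansion 1 ⇑f).coeff 1 = 1 from h1, mul_one]

/-- **The `T_p`-eigenvalue of a normalised eigenvector is its `p`-th Fourier coefficient**:
if `a₁(f) = 1` and `f` is a `T_p`-eigenvector, then `heckeEigenvalue f p = a_p(f)`
(Diamond–Shurman Prop. 5.8.5; Atkin–Lehner 1970, Thm. 3). The named fact
`IsNewform0.heckeEigenvalue_eq_coeff` of `Newforms` is the case of a newform. [cite: DiamondShurman2005, Prop. 5.8.5] -/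
theorem heckeEigenvalue_eq_coeff_of_isNormalized {f : CuspForm (Gamma0 N) k} (h1 : IsNormalized f)
    {p : ℕ} (hp : p.Prime)
    (h : ∃ a : ℂ, (haveI : NeZero p := ⟨hp.ne_zero⟩; heckeT (Gamma0 N) k p f) = a • f) :
    heckeEigenvalue f p = (qExpansion 1 ⇑f).coeff p := by
  haveI : NeZero p := ⟨hp.ne_zero⟩
  exact eq_coeff_of_heckeT_eq_smul hp (heckeT_eq_heckeEigenvalue_smul f p h) h1

/-- **`T_p f = a_p(f) f` for a newform `f`** and every prime `p` (Diamond–Shurman Prop. 5.8.5,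
Def. 5.8.1; Atkin–Lehner 1970, Thm. 3). [cite: DiamondShurman2005, Prop. 5.8.5] -/
theorem IsNewform0.heckeT_eq_coeff_smul {f : CuspForm (Gamma0 N) k} (hf : IsNewform0 f) {p : ℕ}
    [NeZero p] (hp : p.Prime) :
    heckeT (Gamma0 N) k p f = (qExpansion 1 ⇑f).coeff p • f := by
  have h := heckeT_eq_heckeEigenvalue_smul f p (hf.2.1 p hp)
  rwa [heckeEigenvalue_eq_coeff_of_isNormalized hf.2.2 hp (hf.2.1 p hp)] at h

omit [NeZero N] in
/-- The Fourier coefficients of a cusp form with coefficient field `ℚ` are rational. [folklore] -/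
theorem exists_ratCast_eq_coeff_of_coeffField_eq_bot {f : CuspForm (Gamma0 N) k}
    (hQ : coeffField f = ⊥) (n : ℕ) : ∃ q : ℚ, (q : ℂ) = (qExpansion 1 ⇑f).coeff n := by
  have h : (qExpansion 1 ⇑f).coeff n ∈ (⊥ : IntermediateField ℚ ℂ) := hQ ▸ coeff_mem_coeffField f n
  exact IntermediateField.mem_bot.mp h

end Coefficients

/-! ### Multiplicity one for simultaneous eigenforms of all `T_p` -/

section MultiplicityOne

variable {N : ℕ} [NeZero N] {k : ℤ}

/-- **A simultaneous eigenform of all `T_p` with `a₁ = 0` vanishes.** If `g ∈ S_k(Γ₀(N))`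
satisfies `T_p g = λ_p g` for every prime `p` (`T_p = U_p` for `p ∣ N`) and `a₁(g) = 0`, then
`g = 0`: `a₀(g) = 0` (cusp form), and for `n = pm ≥ 2`,
`a_{pm}(g) = a_m(T_p g) - 𝟙_N(p) p^{k-1} a_{m/p}(g) = λ_p a_m(g) - 𝟙_N(p) p^{k-1} a_{m/p}(g) = 0` by
induction (`qExpansion_coeff_heckeT_holds`), so the `q`-expansion of `g` vanishes and `g = 0`
(Diamond–Shurman §5.8: `a_n(f) = a₁(T_n f)`, proof of Thm. 5.8.2 / Prop. 5.8.5). [cite: DiamondShurman2005, §5.8 proof of Thm. 5.8.2] -/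
theorem eq_zero_of_forall_heckeT_eq_smul_of_coeff_one_eq_zero (g : CuspForm (Gamma0 N) k)
    (a : ℕ → ℂ)
    (hg : ∀ (p : ℕ) (hp : p.Prime),
      (haveI : NeZero p := ⟨hp.ne_zero⟩; heckeT (Gamma0 N) k p g) = a p • g)
    (h1 : (qExpansion 1 ⇑g).coeff 1 = 0) : g = 0 := by
  have hΓ := one_mem_strictPeriods_gamma0 N
  have hall : ∀ n, (qExpansion 1 ⇑g).coeff n = 0 := by
    intro n
    induction n using Nat.strong_induction_on with
    | _ n ih =>
      rcases Nat.lt_or_ge n 2 with hn | hn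
      · interval_cases n
        · exact CuspFormClass.qExpansion_coeff_zero g one_pos hΓ
        · exact h1
      · obtain ⟨p, hp, m, rfl⟩ : ∃ p, p.Prime ∧ ∃ m, n = p * m := by
          obtain ⟨p, hp, hpn⟩ := Nat.exists_prime_and_dvd (show n ≠ 1 by omega)
          exact ⟨p, hp, hpn⟩
        haveI : NeZero p := ⟨hp.ne_zero⟩
        have hm0 : 0 < m := Nat.pos_of_ne_zero (by rintro rfl; simp at hn)
        have hm : m < p * m := lt_mul_left hm0 hp.one_lt
        have key := qExpansion_coeff_heckeT_holds N k g p hp m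
        rw [hg p hp, qExpansion_coeff_smul] at key
        have h2 : (qExpansion 1 ⇑g).coeff (m / p) = 0 :=
          ih _ ((Nat.div_le_self m p).trans_lt hm)
        simpa [ih m hm, h2] using key.symm
  have hq : qExpansion 1 ⇑g = 0 := PowerSeries.ext fun n ↦ by simpa using hall n
  have hcoe : (⇑g : ℍ → ℂ) = 0 :=
    (qExpansion_eq_zero_iff one_pos (SlashInvariantFormClass.periodic_comp_ofComplex g hΓ)
      (ModularFormClass.holo g) (ModularFormClass.bdd_at_infty g)).1 hq
  exact DFunLike.coe_injective (by simpa using hcoe)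

/-- **Multiplicity one for simultaneous eigenforms of all `T_p`.** If `f ∈ S_k(Γ₀(N))` is
normalised (`a₁(f) = 1`) with `T_p f = λ_p f` for every prime `p`, and `T_p h = λ_p h` for every
prime `p` (same eigenvalues, `U_p` included for `p ∣ N`), then `h = a₁(h) f`: the difference
`h - a₁(h) f` is a simultaneous eigenform with `a₁ = 0`
(`eq_zero_of_forall_heckeT_eq_smul_of_coeff_one_eq_zero`) (Diamond–Shurman §5.8, proof of
Thm. 5.8.2: "each eigenspace … is `1`-dimensional"). [cite: DiamondShurman2005, §5.8 proof of Thm. 5.8.2] -/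
theorem eq_smul_of_forall_heckeT_eq_smul {f h : CuspForm (Gamma0 N) k} (a : ℕ → ℂ)
    (hf : ∀ (p : ℕ) (hp : p.Prime),
      (haveI : NeZero p := ⟨hp.ne_zero⟩; heckeT (Gamma0 N) k p f) = a p • f)
    (hf1 : IsNormalized f)
    (hh : ∀ (p : ℕ) (hp : p.Prime),
      (haveI : NeZero p := ⟨hp.ne_zero⟩; heckeT (Gamma0 N) k p h) = a p • h) :
    h = (qExpansion 1 ⇑h).coeff 1 • f := by
  set c : ℂ := (qExpansion 1 ⇑h).coeff 1 with hc
  have hg : h - c • f = 0 := by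
    refine eq_zero_of_forall_heckeT_eq_smul_of_coeff_one_eq_zero (h - c • f) a (fun p hp ↦ ?_) ?_
    · haveI : NeZero p := ⟨hp.ne_zero⟩
      simp only [map_sub, map_smul, hh p hp, hf p hp, smul_sub, smul_smul, mul_comm c]
    · rw [qExpansion_coeff_sub_smul, show (qExpansion 1 ⇑f).coeff 1 = 1 from hf1, mul_one, hc,
        sub_self]
  rwa [sub_eq_zero] at hg

/-- **Multiplicity one for a newform among simultaneous eigenforms of all `T_p`**: if `f` is a
newform on `Γ₀(N)` and `T_p h = a_p(f) h` for every prime `p` (`a_p(f) = heckeEigenvalue f p`, the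
eigenvalue of `f`; `U_p` included for `p ∣ N`), then `h ∈ ℂf` (Diamond–Shurman §5.8, Thm. 5.8.2
and its proof; this all-`p` form is elementary, see the module docstring). [cite: DiamondShurman2005, §5.8 proof of Thm. 5.8.2] -/
theorem IsNewform0.mem_span_of_forall_heckeT_eq_smul {f : CuspForm (Gamma0 N) k}
    (hf : IsNewform0 f) (h : CuspForm (Gamma0 N) k)
    (hh : ∀ (p : ℕ) (hp : p.Prime),
      (haveI : NeZero p := ⟨hp.ne_zero⟩; heckeT (Gamma0 N) k p h) = heckeEigenvalue f p • h) :
    h ∈ Submodule.span ℂ ({f} : Set (CuspForm (Gamma0 N) k)) := by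
  have hfT : ∀ (p : ℕ) (hp : p.Prime),
      (haveI : NeZero p := ⟨hp.ne_zero⟩; heckeT (Gamma0 N) k p f) = heckeEigenvalue f p • f :=
    fun p hp ↦ by
      haveI : NeZero p := ⟨hp.ne_zero⟩
      exact heckeT_eq_heckeEigenvalue_smul f p (hf.2.1 p hp)
  rw [eq_smul_of_forall_heckeT_eq_smul (fun p ↦ heckeEigenvalue f p) hfT hf.2.2 hh]
  exact Submodule.smul_mem _ _ (Submodule.mem_span_singleton_self f)

/-- The joint eigenspace of all `T_p` for the eigenvalues of a newform `f` is the line `ℂf`: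
`⋂_p ker(T_p - a_p(f)) = ℂf` (Diamond–Shurman §5.8). [cite: DiamondShurman2005, §5.8 proof of Thm. 5.8.2] -/
theorem IsNewform0.mem_span_iff_forall_heckeT_eq_smul {f : CuspForm (Gamma0 N) k}
    (hf : IsNewform0 f) (h : CuspForm (Gamma0 N) k) :
    h ∈ Submodule.span ℂ ({f} : Set (CuspForm (Gamma0 N) k)) ↔
      ∀ (p : ℕ) (hp : p.Prime),
        (haveI : NeZero p := ⟨hp.ne_zero⟩; heckeT (Gamma0 N) k p h) = heckeEigenvalue f p • h := by
  refine ⟨fun hmem p hp ↦ ?_, hf.mem_span_of_forall_heckeT_eq_smul h⟩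
  haveI : NeZero p := ⟨hp.ne_zero⟩
  obtain ⟨c, rfl⟩ := Submodule.mem_span_singleton.mp hmem
  rw [map_smul, heckeT_eq_heckeEigenvalue_smul f p (hf.2.1 p hp), smul_comm]

end MultiplicityOne

end Literature.NumberTheory.EllipticCurves.ModularForms

end
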